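import Literature.Computability.Complexity.GateEliminationDoomed

/-!
# Gate elimination: eliminations with exact wires

The elimination data of Rules 2/3 (`ElimData`, `ElimDataD`) record the new circuit only up to
monotone summaries (gates fed by a constant, doomed gates). The case analysis of Li–Yang §4.1
(Cases 5–8, Lemma 3.12) reasons about the exact local structure after each elimination ("`u`
should be a `2`-variable feeding exactly `C` and `E`, hence `B` should be a `1`-gate
originally", Case 5.2). `ElimDataW` records the wires, output, functions and xor-part of the
new circuit exactly: every wire into the eliminated gate `k₀` is replaced by one node `repl`
(the constant it computes, Rule 2; its live input, Rule 3), all other wires are kept, functions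
change only by negating gate wires and outputs; whence the exact out-degrees (`fanout_pull_add`).

## References

* J. Li, T. Yang, *3.1n − o(n) circuit lower bounds for explicit functions*, STOC 2022;
  ECCC TR21-023, §3.3 (Rules 2, 3), Lemma 3.11.
-/

namespace Literature.Computability.Complexity

open Finset

namespace Node

variable {n m m' : ℕ}

/-- Embedding the nodes of a circuit with gate set `Fin m'` along a map of gates. [folklore] -/
def embed (ι : Fin m' → Fin m) : Node n m' → Node n m
  | .const b => .const b
  | .var i => .var i
  | .gate k => .gate (ι k)

variable (ι : Fin m' → Fin m)

/-- Embedding a constant. [folklore] -/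
@[simp] theorem embed_const (b : Bool) : (Node.const b : Node n m').embed ι = .const b := rfl

/-- Embedding a variable. [folklore] -/
@[simp] theorem embed_var (i : Fin n) : (Node.var i : Node n m').embed ι = .var i := rfl

/-- Embedding a gate. [folklore] -/
@[simp] theorem embed_gate (k : Fin m') : (Node.gate k : Node n m').embed ι = .gate (ι k) := rfl

/-- The embedding is injective for an injective map of gates. [folklore] -/
theorem embed_injective (hι : Function.Injective ι) : Function.Injective (embed (n := n) ι) := by
  intro u v h
  cases u <;> cases v <;> simp only [embed, Node.const.injEq, Node.var.injEq, Node.gate.injEq,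
    reduceCtorEq] at h ⊢
  · exact h
  · exact h
  · exact hι h

/-- An embedded node is a constant iff the node is. [folklore] -/
theorem embed_eq_const_iff {u : Node n m'} {b : Bool} : u.embed ι = .const b ↔ u = .const b := by
  cases u <;> simp [embed]

/-- An embedded node is a variable iff the node is. [folklore] -/
theorem embed_eq_var_iff {u : Node n m'} {i : Fin n} : u.embed ι = .var i ↔ u = .var i := by
  cases u <;> simp [embed]

/-- `unskip` is the embedding along the reindexing. [folklore] -/
theorem unskip_eq_embed (k₀ : Fin m) (ε : Fin m' ≃ {k : Fin m // k ≠ k₀}) (u : Node n m') :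
    u.unskip k₀ ε = u.embed fun k => (ε k : Fin m) := by
  cases u <;> rfl

end Node

namespace Semicircuit

variable {n : ℕ}

/-! ### Elimination data with exact wires -/

/-- **Elimination data with exact wires** (refining `ElimDataD`): the wires into `k₀` are
replaced by the node `repl ≠ k₀` — a constant, or a wire of `k₀` — and all other wires are kept;
the output is kept (or replaced likewise); each gate function changes at most by negating some
gate wires and the output; the xor-part is kept. [cite: LiYang2022, §3.3 (Rules 2, 3)] -/
structure ElimDataW (C : Semicircuit n) (k₀ : Fin C.m) (f : (Fin n → ZMod 2) → Bool) (R : RdqSource n)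
    (αφ αI αQ : ℝ) (P : Finset (Fin C.m × Fin C.m)) (δ : ℝ) extends ElimDataD C k₀ f R αφ αI αQ P δ where
  /-- the node replacing the wires into `k₀` -/
  repl : Node n C.m
  /-- it is not `k₀` -/
  repl_ne : repl ≠ .gate k₀
  /-- it is a constant or a wire of `k₀` -/
  repl_cases : (∃ b, repl = .const b) ∨ ∃ a, C.arg k₀ a = repl
  /-- it is a constant if `k₀` is trivialized -/
  repl_const_of_triv : (∃ (a₀ : Fin 2) (b : Bool), C.arg k₀ a₀ = .const b ∧
    C.liveFn k₀ a₀ b false = C.liveFn k₀ a₀ b true) → ∃ b, repl = .const b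
  /-- `k₀` does not read itself -/
  not_reads_self : ∀ a, C.arg k₀ a ≠ .gate k₀
  /-- the wires of the new circuit -/
  arg_eq : ∀ k' a, (C'.arg k' a).embed ι = if C.arg (ι k') a = .gate k₀ then repl else C.arg (ι k') a
  /-- the output of the new circuit -/
  out_eq : C'.out.embed ι = if C.out = .gate k₀ then repl else C.out
  /-- the functions of the new circuit: negations on gate wires and on the output only -/
  op_eq : ∀ k', ∃ (σ : Fin 2 → Bool) (τ : Bool), (∀ a, σ a = true → ∃ g, C.arg (ι k') a = .gate g) ∧
    ∀ p q, C'.op k' p q = (C.op (ι k') (p ^^ σ 0) (q ^^ σ 1) ^^ τ)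
  /-- the xor-part of the new circuit -/
  mem_xorPart_iff : ∀ k', k' ∈ C'.xorPart ↔ ι k' ∈ C.xorPart
  /-- the potential grows by at most one (Lemma 3.11) -/
  potential_le : C'.potential P' ≤ C.potential P + 1
  /-- new troubled gates are caused by an input of `k₀` (Lemma 3.11: "the potential increment is
  caused only by direct introduction of troubled gates or packs, which are either `I₁` (or `I₂`)
  or fed by them after the normalization") -/
  causedBy_of_new_troubled : ∀ k', C'.Troubled k' → ¬ C.Troubled (ι k') → ∃ a, CausedBy C C' ι (C.arg k₀ a) k'
  /-- the eliminated gate is not troubled -/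
  not_troubled : ¬ C.Troubled k₀

namespace ElimDataW

variable {C : Semicircuit n} {k₀ : Fin C.m} {f : (Fin n → ZMod 2) → Bool} {R : RdqSource n}
  {αφ αI αQ : ℝ} {P : Finset (Fin C.m × Fin C.m)} {δ δ' : ℝ}

/-- Weakening the measure bound. [folklore] -/
def mono (E : ElimDataW C k₀ f R αφ αI αQ P δ) (h : δ' ≤ δ) : ElimDataW C k₀ f R αφ αI αQ P δ' :=
  { E with measure_le := E.measure_le.trans (by linarith) }

variable (E : ElimDataW C k₀ f R αφ αI αQ P δ)

/-- The embedding of nodes along `ι`. [folklore] -/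
abbrev embed (u : Node n E.C'.m) : Node n C.m := u.embed E.ι

/-- The embedding of nodes is injective. [folklore] -/
theorem embed_injective : Function.Injective E.embed := Node.embed_injective _ E.ι_injective

/-- An embedded node is not `k₀`. [folklore] -/
theorem embed_ne (u : Node n E.C'.m) : E.embed u ≠ .gate k₀ := by
  cases u with
  | const b => exact fun h => by cases h
  | var i => exact fun h => by cases h
  | gate k => exact fun h => E.ι_ne k (Node.gate.inj h)

/-- Pulling a node of `C` other than `k₀` back to `C'` (junk at `k₀`). [folklore] -/
noncomputable def pull : Node n C.m → Node n E.C'.m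
  | .const b => .const b
  | .var i => .var i
  | .gate k => if h : k = k₀ then .const false else .gate (Classical.choose (E.ι_surj k h))

/-- `embed ∘ pull = id` away from `k₀`. [folklore] -/
theorem embed_pull {u : Node n C.m} (hu : u ≠ .gate k₀) : E.embed (E.pull u) = u := by
  cases u with
  | const b => rfl
  | var i => rfl
  | gate k =>
    have hk : k ≠ k₀ := fun h => hu (congrArg Node.gate h)
    simp only [pull, hk, dite_false, Node.embed, Node.gate.injEq]
    exact Classical.choose_spec (E.ι_surj k hk)

/-- `pull ∘ embed = id`. [folklore] -/
theorem pull_embed (u : Node n E.C'.m) : E.pull (E.embed u) = u :=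
  E.embed_injective (E.embed_pull (E.embed_ne u))

/-- Pulling back a variable. [folklore] -/
@[simp] theorem pull_var (i : Fin n) : E.pull (.var i) = .var i := rfl

/-- Pulling back a constant. [folklore] -/
@[simp] theorem pull_const (b : Bool) : E.pull (.const b) = .const b := rfl

/-- Pulling back a kept gate. [folklore] -/
theorem pull_ι (k' : Fin E.C'.m) : E.pull (.gate (E.ι k')) = .gate k' := E.pull_embed (.gate k')

/-- **The wires of `C'`**, pulled back. [folklore] -/
theorem arg_eq' (k' : Fin E.C'.m) (a : Fin 2) :
    E.C'.arg k' a = E.pull (if C.arg (E.ι k') a = .gate k₀ then E.repl else C.arg (E.ι k') a) := by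
  rw [← E.arg_eq, pull_embed]

/-- A wire of `C'` reads the constant `b` iff the corresponding wire of `C` did, or it read
`k₀` and `repl = b`. [folklore] -/
theorem arg_eq_const_iff (k' : Fin E.C'.m) (a : Fin 2) (b : Bool) :
    E.C'.arg k' a = .const b ↔
      (C.arg (E.ι k') a = .const b ∨ (C.arg (E.ι k') a = .gate k₀ ∧ E.repl = .const b)) := by
  rw [← Node.embed_eq_const_iff E.ι, E.arg_eq]
  by_cases h : C.arg (E.ι k') a = .gate k₀
  · rw [if_pos h, h]; simp
  · rw [if_neg h]; simp [h]

/-- A wire of `C'` reads the variable `x_i` iff the corresponding wire of `C` did, or it read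
`k₀` and `repl = x_i`. [folklore] -/
theorem arg_eq_var_iff (k' : Fin E.C'.m) (a : Fin 2) (i : Fin n) :
    E.C'.arg k' a = .var i ↔
      (C.arg (E.ι k') a = .var i ∨ (C.arg (E.ι k') a = .gate k₀ ∧ E.repl = .var i)) := by
  rw [← Node.embed_eq_var_iff E.ι, E.arg_eq]
  by_cases h : C.arg (E.ι k') a = .gate k₀
  · rw [if_pos h, h]; simp
  · rw [if_neg h]; simp [h]

/-- A wire of `C'` reads the kept gate `k''` iff the corresponding wire of `C` did, or it read
`k₀` and `repl` is that gate. [folklore] -/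
theorem arg_eq_gate_iff (k' : Fin E.C'.m) (a : Fin 2) (k'' : Fin E.C'.m) :
    E.C'.arg k' a = .gate k'' ↔
      (C.arg (E.ι k') a = .gate (E.ι k'') ∨ (C.arg (E.ι k') a = .gate k₀ ∧ E.repl = .gate (E.ι k''))) := by
  have hinj : E.C'.arg k' a = .gate k'' ↔ (E.C'.arg k' a).embed E.ι = (Node.gate k'' : Node n E.C'.m).embed E.ι :=
    ⟨fun h => by rw [h], fun h => E.embed_injective h⟩
  rw [hinj, E.arg_eq, Node.embed_gate]
  by_cases h : C.arg (E.ι k') a = .gate k₀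
  · rw [if_pos h, h]
    simp only [Node.gate.injEq, true_and]
    exact ⟨fun h' => Or.inr h', fun h' => h'.resolve_left fun h'' => E.ι_ne k'' h''.symm⟩
  · rw [if_neg h]; simp [h]

/-- ∧-type functions are kept. [folklore] -/
theorem isAndOp_iff (k' : Fin E.C'.m) : IsAndOp (E.C'.op k') ↔ IsAndOp (C.op (E.ι k')) := by
  obtain ⟨σ, τ, -, hop⟩ := E.op_eq k'
  have : E.C'.op k' = fun p q => (C.op (E.ι k') (p ^^ σ 0) (q ^^ σ 1) ^^ τ) := by
    funext p q; exact hop p q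
  rw [this]
  cases τ
  · simp only [Bool.xor_false]; exact isAndOp_comp_xor_iff _ _ _
  · have : (fun p q => (C.op (E.ι k') (p ^^ σ 0) (q ^^ σ 1) ^^ true)) =
        fun p q => !(C.op (E.ι k') (p ^^ σ 0) (q ^^ σ 1)) := by
      funext p q; cases C.op (E.ι k') (p ^^ σ 0) (q ^^ σ 1) <;> rfl
    rw [this, isAndOp_not_comp_iff]; exact isAndOp_comp_xor_iff _ _ _

/-- **The live function of a kept gate fed by a constant** is the old one up to negating the
argument and the value (so being trivialized, resp. degenerate, is kept). [folklore] -/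
theorem liveFn_eq (k' : Fin E.C'.m) {a : Fin 2} {b : Bool} (h : C.arg (E.ι k') a = .const b) :
    E.C'.arg k' a = .const b ∧
      ∃ s τ : Bool, ∀ t, E.C'.liveFn k' a b t = (C.liveFn (E.ι k') a b (t ^^ s) ^^ τ) := by
  refine ⟨(E.arg_eq_const_iff k' a b).mpr (Or.inl h), ?_⟩
  obtain ⟨σ, τ, hσ, hop⟩ := E.op_eq k'
  have hσa : σ a = false := by
    cases hs : σ a
    · rfl
    · obtain ⟨g, hg⟩ := hσ a hs
      rw [h] at hg; cases hg
  refine ⟨σ a.rev, τ, fun t => ?_⟩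
  unfold liveFn
  obtain rfl | rfl : a = 0 ∨ a = 1 := by fin_cases a <;> simp
  · rw [if_pos rfl, if_pos rfl, hop, hσa, Bool.xor_false]; rfl
  · rw [if_neg (by decide), if_neg (by decide), hop, hσa, Bool.xor_false]; rfl

/-! #### Out-degrees -/

/-- **Out-degrees after the elimination**: a node `u ≠ k₀` of `C` loses the wires from `k₀`
and, if it is the replacement node, gains the wires that went into `k₀`.
[cite: LiYang2022, §3.3 (Rules 1–3)] -/
theorem fanout_pull_add {u : Node n C.m} (hu : u ≠ .gate k₀) :
    E.C'.fanout (E.pull u) + (univ.filter fun a : Fin 2 => C.arg k₀ a = u).card =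
      C.fanout u + if u = E.repl then C.fanout (.gate k₀) else 0 := by
  classical
  -- wires of `C'` in terms of wires of `C`
  have hwire : ∀ (k' : Fin E.C'.m) (a : Fin 2), E.C'.arg k' a = E.pull u ↔
      (C.arg (E.ι k') a = u ∨ (C.arg (E.ι k') a = .gate k₀ ∧ u = E.repl)) := by
    intro k' a
    rw [E.arg_eq' k' a]
    constructor
    · intro h
      have h' := congrArg E.embed h
      rw [E.embed_pull hu, E.embed_pull] at h'
      · by_cases hr : C.arg (E.ι k') a = .gate k₀
        · rw [if_pos hr] at h'; exact Or.inr ⟨hr, h'.symm⟩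
        · rw [if_neg hr] at h'; exact Or.inl h'
      · by_cases hr : C.arg (E.ι k') a = .gate k₀
        · rw [if_pos hr]; exact E.repl_ne
        · rw [if_neg hr]; exact hr
    · rintro (h | ⟨h, rfl⟩)
      · rw [h, if_neg hu]
      · rw [h, if_pos rfl]
  -- reindex the sum over the gates of `C'` as a sum over the gates `≠ k₀` of `C`
  unfold fanout
  have hsum : ∀ (F : Fin C.m → ℕ), ∑ k' : Fin E.C'.m, F (E.ι k') = ∑ k ∈ univ.erase k₀, F k := by
    intro F
    rw [← sum_image (f := F) (s := (univ : Finset (Fin E.C'.m))) (g := E.ι) (fun a _ b _ h => E.ι_injective h)]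
    congr 1
    ext k
    simp only [mem_image, mem_univ, true_and, mem_erase, ne_eq, and_true]
    constructor
    · rintro ⟨k', rfl⟩; exact E.ι_ne k'
    · intro hk; obtain ⟨k', hk'⟩ := E.ι_surj k hk; exact ⟨k', hk'⟩
  have step1 : ∑ k' : Fin E.C'.m, (univ.filter fun a : Fin 2 => E.C'.arg k' a = E.pull u).card =
      ∑ k' : Fin E.C'.m, ((univ.filter fun a : Fin 2 => C.arg (E.ι k') a = u).card +
        if u = E.repl then (univ.filter fun a : Fin 2 => C.arg (E.ι k') a = .gate k₀).card else 0) := by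
    refine sum_congr rfl fun k' _ => ?_
    by_cases hur : u = E.repl
    · rw [if_pos hur, ← card_union_of_disjoint]
      · congr 1; ext a
        simp only [mem_filter, mem_univ, true_and, mem_union, hwire]
        constructor
        · rintro (h | ⟨h, -⟩); exacts [Or.inl h, Or.inr h]
        · rintro (h | h); exacts [Or.inl h, Or.inr ⟨h, hur⟩]
      · rw [disjoint_filter]; intro a _ h1 h2; rw [h1] at h2; exact hu h2
    · rw [if_neg hur, add_zero]
      congr 1; ext a
      simp only [mem_filter, mem_univ, true_and, hwire, hur, and_false, or_false]
  rw [step1, sum_add_distrib, hsum fun k => (univ.filter fun a : Fin 2 => C.arg k a = u).card]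
  set A : Fin C.m → ℕ := fun k => (univ.filter fun a : Fin 2 => C.arg k a = u).card with hA
  set B : Fin C.m → ℕ := fun k => (univ.filter fun a : Fin 2 => C.arg k a = .gate k₀).card with hB
  have htot : (∑ k ∈ univ.erase k₀, A k) + A k₀ = ∑ k, A k := sum_erase_add _ _ (mem_univ k₀)
  have htot' : (∑ k ∈ univ.erase k₀, B k) + B k₀ = ∑ k, B k := sum_erase_add _ _ (mem_univ k₀)
  have hself : B k₀ = 0 := by
    rw [hB, card_eq_zero, filter_eq_empty_iff]; exact fun a _ => E.not_reads_self a
  have hAk₀ : A k₀ = (univ.filter fun a : Fin 2 => C.arg k₀ a = u).card := rfl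
  by_cases hur : u = E.repl
  · simp only [if_pos hur]
    rw [hsum B]
    show (∑ k ∈ univ.erase k₀, A k) + (∑ k ∈ univ.erase k₀, B k) + A k₀ = (∑ k, A k) + ∑ k, B k
    omega
  · simp only [if_neg hur, sum_const_zero, add_zero]
    show (∑ k ∈ univ.erase k₀, A k) + A k₀ = ∑ k, A k
    omega

/-- Out-degree of a variable other than the replacement node. [folklore] -/
theorem fanout_var_add {i : Fin n} (hi : E.repl ≠ .var i) :
    E.C'.fanout (.var i) + (univ.filter fun a : Fin 2 => C.arg k₀ a = .var i).card = C.fanout (.var i) := by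
  have := E.fanout_pull_add (u := .var i) (by simp)
  rw [if_neg (fun h => hi h.symm), add_zero] at this
  exact this

/-- Out-degree of a kept gate other than the replacement node. [folklore] -/
theorem fanout_gate_add {k' : Fin E.C'.m} (hk : E.repl ≠ .gate (E.ι k')) :
    E.C'.fanout (.gate k') + (univ.filter fun a : Fin 2 => C.arg k₀ a = .gate (E.ι k')).card =
      C.fanout (.gate (E.ι k')) := by
  have := E.fanout_pull_add (u := .gate (E.ι k')) (fun h => E.ι_ne k' (Node.gate.inj h))
  rw [if_neg (fun h => hk h.symm), add_zero, pull_ι] at this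
  exact this

/-- Out-degree of the replacement node. [folklore] -/
theorem fanout_repl_add :
    E.C'.fanout (E.pull E.repl) + (univ.filter fun a : Fin 2 => C.arg k₀ a = E.repl).card =
      C.fanout E.repl + C.fanout (.gate k₀) := by
  have := E.fanout_pull_add (u := E.repl) E.repl_ne
  rw [if_pos rfl] at this
  exact this

/-- **Influential inputs do not appear**: a variable of out-degree `≥ 1` afterwards had
out-degree `≥ 1` before (if it is the replacement node, `k₀` read it). [cite: LiYang2022, Def. 3.6] -/
theorem influential_subset (R : RdqSource n) : E.C'.influential R ⊆ C.influential R := by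
  classical
  intro i hi
  unfold influential at hi ⊢
  rw [mem_filter] at hi ⊢
  refine ⟨mem_univ _, ?_⟩
  rcases hi.2 with h | h
  · left
    by_cases hri : E.repl = .var i
    · -- `k₀` read `x_i`
      rcases E.repl_cases with ⟨b, hb⟩ | ⟨a, ha⟩
      · rw [hri] at hb; cases hb
      · rw [hri] at ha
        unfold fanout
        refine Nat.one_le_iff_ne_zero.mpr fun hsum => ?_
        have := (sum_eq_zero_iff.mp hsum) k₀ (mem_univ _)
        rw [card_eq_zero, filter_eq_empty_iff] at this
        exact this (mem_univ a) ha
    · have := E.fanout_var_add hri; omega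
  · exact Or.inr h

/-- A troubled gate of `C` does not read `k₀` (it reads variables), so its wires are kept:
it reads `x_z` afterwards iff it did. [folklore] -/
theorem reads_var_iff_of_troubled {k' : Fin E.C'.m} (hT : C.Troubled (E.ι k')) (z : Fin n) :
    (∃ a, E.C'.arg k' a = .var z) ↔ ∃ a, C.arg (E.ι k') a = .var z := by
  have hng : ∀ a, C.arg (E.ι k') a ≠ .gate k₀ := by
    obtain ⟨-, -, x, y, -, hr, -, -⟩ := hT
    intro a h
    have : C.arg (E.ι k') a ∈ Set.range (C.arg (E.ι k')) := ⟨a, rfl⟩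
    rw [hr, h] at this
    rcases this with h' | h' <;> cases h'
  constructor
  · rintro ⟨a, ha⟩
    rw [E.arg_eq_var_iff] at ha
    rcases ha with ha | ⟨ha, -⟩
    · exact ⟨a, ha⟩
    · exact absurd ha (hng a)
  · rintro ⟨a, ha⟩
    exact ⟨a, (E.arg_eq_var_iff k' a z).mpr (Or.inl ha)⟩

/-- Adjacency of gates troubled before and after transfers. [folklore] -/
theorem adjacent_of_troubled (k k' : Fin E.C'.m) (hk : C.Troubled (E.ι k)) (hk' : C.Troubled (E.ι k'))
    (hadj : C.Adjacent (E.ι k) (E.ι k')) : E.C'.Adjacent k k' := by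
  obtain ⟨z, hz, hz'⟩ := hadj
  exact ⟨z, (E.reads_var_iff_of_troubled hk z).mpr hz, (E.reads_var_iff_of_troubled hk' z).mpr hz'⟩

/-- **Exact potential accounting with user-chosen covers**: for any packing of `C` and any two
good sets covering the new troubled gates, the new circuit has a packing with
`Φ'' ≤ Φ + [A ≠ ∅] + [B ≠ ∅]` (the potential transfer lemma, with the embedding of the
elimination; e.g. `A = B = ∅` when no troubled gate is introduced, as in Li–Yang's "it has
`ΔΦ ≤ 0`"). [cite: LiYang2022, §3.3, Lemma 3.11] -/
theorem exists_packing_of_cover {P₀ : Finset (Fin C.m × Fin C.m)} (hP₀ : C.IsPacking P₀)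
    (A B : Finset (Fin E.C'.m))
    (hcover : ∀ k', E.C'.Troubled k' → ¬ C.Troubled (E.ι k') → k' ∈ A ∨ k' ∈ B)
    (hA : E.C'.GoodCover A) (hB : E.C'.GoodCover B) :
    ∃ P'' : Finset (Fin E.C'.m × Fin E.C'.m), E.C'.IsPacking P'' ∧
      E.C'.potential P'' ≤ C.potential P₀ + (if A = ∅ then 0 else 1 : ℕ) + (if B = ∅ then 0 else 1 : ℕ) := by
  refine exists_packing_transfer C E.C' E.ι E.ι_injective hP₀ (fun p hp => ?_)
    (fun k k' _ _ hk hk' hadj => E.adjacent_of_troubled k k' hk hk' hadj) A B hcover hA hB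
  obtain ⟨-, hT1, hT2, -⟩ := hP₀.1 p hp
  exact ⟨E.ι_surj p.1 fun h => E.not_troubled (h ▸ hT1), E.ι_surj p.2 fun h => E.not_troubled (h ▸ hT2)⟩

end ElimDataW

/-! ### Producers -/

section Producers

variable {C : Semicircuit n} {k₀ : Fin C.m} {f : (Fin n → ZMod 2) → Bool} {R : RdqSource n} {αφ αI : ℝ}

/-- The canonical embedding after `removeGate k₀ (skipEquiv k₀)` composed with a same-size
surgery: wires. [folklore] -/
private theorem embed_skip {u : Node n C.m} (hu : u ≠ .gate k₀) :
    (u.skip k₀ (C.skipEquiv k₀)).embed (fun k => (C.skipEquiv k₀ k : Fin C.m)) = u := by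
  rw [← Node.unskip_eq_embed, Node.unskip_skip _ _ hu]

/-- **Exact elimination data for a trivialized gate** (Rule 2). [cite: LiYang2022, Lemma 3.11 (Rule 2)] -/
noncomputable def elimDataWTriv (hF : C.Fair) (hC : C.ComputesRestr f R)
    {P : Finset (Fin C.m × Fin C.m)} (hP : C.IsPacking P) {a₀ : Fin 2} {b₀ : Bool} (h₀ : C.arg k₀ a₀ = .const b₀)
    (htriv : C.liveFn k₀ a₀ b₀ false = C.liveFn k₀ a₀ b₀ true) (hout : C.out ≠ .gate k₀)
    (hφ : 0 ≤ αφ) (hI : 0 ≤ αI) (αQ : ℝ) : ElimDataW C k₀ f R αφ αI αQ P (1 - αφ) := by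
  have hself := hF.not_reads_self_of_const h₀
  let c := C.liveFn k₀ a₀ b₀ false
  have h0₁ : ∀ k a, (C.redirect k₀ (.const c) false (C.redirectOK_const k₀ c)).arg k a ≠ .gate k₀ :=
    (fanout_eq_zero_iff _ _).mp (C.fanout_redirect_self k₀ _ false _ (fun h => by cases h))
  refine
    { toElimDataD := elimDataDTriv hF hC hP h₀ htriv hout hφ hI αQ
      repl := .const c
      repl_ne := fun h => by cases h
      repl_cases := Or.inl ⟨c, rfl⟩
      repl_const_of_triv := fun _ => ⟨c, rfl⟩
      not_reads_self := hself
      arg_eq := fun k' a => ?_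
      out_eq := ?_
      op_eq := fun k' => ⟨fun _ => false, false, (fun a h => by cases h), fun p q => ?_⟩
      mem_xorPart_iff := fun k' => ⟨fun h => (mem_filter.mp h).2, fun h => mem_filter.mpr ⟨mem_univ _, h⟩⟩
      potential_le := ?_
      causedBy_of_new_troubled := fun k' hT' hT => ?_
      not_troubled := not_troubled_of_reads_const h₀ }
  · show (((C.redirect k₀ (.const c) false (C.redirectOK_const k₀ c)).arg (C.skipEquiv k₀ k') a).skip k₀
      (C.skipEquiv k₀)).embed (fun k => (C.skipEquiv k₀ k : Fin C.m)) = _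
    rw [embed_skip (C := C) (h0₁ _ a)]; rfl
  · show ((C.out).skip k₀ (C.skipEquiv k₀)).embed (fun k => (C.skipEquiv k₀ k : Fin C.m)) = _
    rw [embed_skip (C := C) hout, if_neg hout]
  · show C.op _ (p ^^ (false && _)) (q ^^ (false && _)) = (C.op _ (p ^^ false) (q ^^ false) ^^ false)
    rw [Bool.false_and, Bool.false_and, Bool.xor_false, Bool.xor_false, Bool.xor_false]; rfl
  · -- the packing chosen by `elimDataDTriv`
    have hk₀ : ¬ C.Troubled k₀ := not_troubled_of_reads_const h₀
    have hP₁ := (C.measure_redirect_const' k₀ hk₀ c false αφ αI αQ hP R).1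
    have hex := (C.redirect k₀ (.const c) false (C.redirectOK_const k₀ c)).exists_packing_removeGate_le k₀
      ((C.redirect k₀ (.const c) false (C.redirectOK_const k₀ c)).skipEquiv k₀) h0₁ hP₁
    have h := (Classical.choose_spec hex).2
    have hargs₁ : ∀ a, (C.redirect k₀ (.const c) false (C.redirectOK_const k₀ c)).arg k₀ a = C.arg k₀ a :=
      fun a => by
        show (if C.arg k₀ a = .gate k₀ then Node.const c else C.arg k₀ a) = _; rw [if_neg (hself a)]
    have hpot : (C.redirect k₀ (.const c) false (C.redirectOK_const k₀ c)).potential P = C.potential P := by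
      unfold potential; rw [C.troubledCount_redirect_const k₀ h₀ c false]
    refine h.trans (le_of_eq ?_)
    rw [hpot, if_pos]
    rw [hargs₁, hargs₁]
    obtain rfl | rfl : a₀ = 0 ∨ a₀ = 1 := by fin_cases a₀ <;> simp
    · exact Or.inr (Or.inl ⟨b₀, h₀⟩)
    · exact Or.inr (Or.inr ⟨b₀, h₀⟩)
  · have hT₁ : ¬ (C.redirect k₀ (.const c) false (C.redirectOK_const k₀ c)).Troubled (C.skipEquiv k₀ k') :=
      fun h => hT ((C.troubled_redirect_const_iff k₀ h₀ c false _).mp h)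
    obtain ⟨a, ha⟩ := (C.redirect k₀ (.const c) false (C.redirectOK_const k₀ c)).causedBy_of_new_troubled_removeGate
      k₀ (C.skipEquiv k₀) h0₁ hT' hT₁
    refine ⟨a, ?_⟩
    have hargs₁ : (C.redirect k₀ (.const c) false (C.redirectOK_const k₀ c)).arg k₀ a = C.arg k₀ a := by
      show (if C.arg k₀ a = .gate k₀ then Node.const c else C.arg k₀ a) = _; rw [if_neg (hself a)]
    rw [hargs₁] at ha
    exact ha

/-- **Exact elimination data for a degenerate gate that is not the output** (Rule 3).
[cite: LiYang2022, Lemma 3.11 (Rule 3)] -/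
noncomputable def elimDataWBypass (hF : C.Fair) (hC : C.ComputesRestr f R)
    {P : Finset (Fin C.m × Fin C.m)} (hP : C.IsPacking P) {a₀ : Fin 2} {b₀ : Bool} (neg : Bool)
    (h₀ : C.arg k₀ a₀ = .const b₀) (hdeg : ∀ t, C.liveFn k₀ a₀ b₀ t = (t ^^ neg)) (hout : C.out ≠ .gate k₀)
    (hφ : 0 ≤ αφ) (hI : 0 ≤ αI) (αQ : ℝ) : ElimDataW C k₀ f R αφ αI αQ P (1 - αφ) := by
  have hself := hF.not_reads_self_of_const h₀
  have h0₁ : ∀ k a, (C.redirect k₀ (C.arg k₀ a₀.rev) neg (C.redirectOK_live k₀ a₀)).arg k a ≠ .gate k₀ :=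
    C.not_reads_redirect_live neg (hself _)
  refine
    { toElimDataD := elimDataDBypass hF hC hP neg h₀ hdeg hout hφ hI αQ
      repl := C.arg k₀ a₀.rev
      repl_ne := hself _
      repl_cases := Or.inr ⟨_, rfl⟩
      repl_const_of_triv := fun ⟨a₁, b₁, h₁, htriv⟩ => ?_
      not_reads_self := hself
      arg_eq := fun k' a => ?_
      out_eq := ?_
      op_eq := fun k' => ⟨fun a => neg && decide (C.arg (C.skipEquiv k₀ k') a = .gate k₀), false,
        fun a h => ⟨k₀, ?_⟩, fun p q => ?_⟩
      mem_xorPart_iff := fun k' => ⟨fun h => (mem_filter.mp h).2, fun h => mem_filter.mpr ⟨mem_univ _, h⟩⟩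
      potential_le := ?_
      causedBy_of_new_troubled := fun k' hT' hT => ?_
      not_troubled := not_troubled_of_reads_const h₀ }
  · -- trivialized at `a₁`: then `a₁` is the live position, which holds a constant
    by_cases ha : a₁ = a₀
    · subst ha
      rw [h₀] at h₁; cases h₁
      rw [hdeg, hdeg] at htriv
      cases neg <;> simp at htriv
    · have : a₁ = a₀.rev := by
        obtain rfl | rfl : a₀ = 0 ∨ a₀ = 1 := by fin_cases a₀ <;> simp
        all_goals obtain rfl | rfl : a₁ = 0 ∨ a₁ = 1 := by fin_cases a₁ <;> simp
        all_goals first | exact absurd rfl ha | rfl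
      exact ⟨b₁, this ▸ h₁⟩
  · show (((C.redirect k₀ (C.arg k₀ a₀.rev) neg (C.redirectOK_live k₀ a₀)).arg (C.skipEquiv k₀ k') a).skip k₀
      (C.skipEquiv k₀)).embed (fun k => (C.skipEquiv k₀ k : Fin C.m)) = _
    rw [embed_skip (C := C) (h0₁ _ a)]; rfl
  · show ((C.out).skip k₀ (C.skipEquiv k₀)).embed (fun k => (C.skipEquiv k₀ k : Fin C.m)) = _
    rw [embed_skip (C := C) hout, if_neg hout]
  · show C.arg (C.skipEquiv k₀ k') a = .gate k₀
    by_contra hne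
    change (neg && decide (C.arg (C.skipEquiv k₀ k') a = .gate k₀)) = true at h
    rw [decide_eq_false hne, Bool.and_false] at h
    cases h
  · show C.op _ (p ^^ (neg && _)) (q ^^ (neg && _)) = (C.op _ (p ^^ (neg && _)) (q ^^ (neg && _)) ^^ false)
    rw [Bool.xor_false]; rfl
  · -- the packing chosen by `elimDataBypass`
    have hk₀ : ¬ C.Troubled k₀ := not_troubled_of_reads_const h₀
    have hex := C.exists_packing_bypass_le k₀ a₀ neg (C.skipEquiv k₀) hself hk₀ hP
    have h := (Classical.choose_spec hex).2
    refine h.trans (le_of_eq ?_)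
    rw [if_pos (Or.inr ⟨b₀, h₀⟩)]
  · rcases C.causedBy_of_new_troubled_bypass k₀ a₀ neg (C.skipEquiv k₀) hself hT' hT with h | h
    · exact ⟨a₀.rev, h⟩
    · exact ⟨a₀, h⟩

namespace ElimDataW

variable {αQ δ : ℝ} {P : Finset (Fin C.m × Fin C.m)}

/-- Transport along `setOut v`, when `v` and the old output have the same image.
[folklore] -/
def ofSetOut {v : Node n C.m} (E : ElimDataW (C.setOut v) k₀ f R αφ αI αQ P δ)
    (hv : (if v = .gate k₀ then E.repl else v) = if C.out = .gate k₀ then E.repl else C.out) :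
    ElimDataW C k₀ f R αφ αI αQ P δ :=
  { E.toElimDataD.ofSetOut with
    repl := E.repl, repl_ne := E.repl_ne, repl_cases := E.repl_cases, repl_const_of_triv := E.repl_const_of_triv
    not_reads_self := E.not_reads_self, arg_eq := E.arg_eq
    out_eq := E.out_eq.trans hv
    op_eq := E.op_eq, mem_xorPart_iff := E.mem_xorPart_iff, potential_le := E.potential_le
    causedBy_of_new_troubled := E.causedBy_of_new_troubled
    not_troubled := E.not_troubled }

/-- Transport along `flipGate k₁`, `k₁ ≠ k₀` (functions get negated on the wires reading `k₁`
and at `k₁`). [folklore] -/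
def ofFlipGate {k₁ : Fin C.m} (E : ElimDataW (C.flipGate k₁) k₀ f R αφ αI αQ P δ) (hk : k₀ ≠ k₁) :
    ElimDataW C k₀ f R αφ αI αQ P δ :=
  { E.toElimDataD.ofFlipGate hk with
    repl := E.repl, repl_ne := E.repl_ne, repl_cases := E.repl_cases
    repl_const_of_triv := fun ⟨a₀, b, h₀, htriv⟩ => E.repl_const_of_triv ⟨a₀, b, h₀, by
      rw [C.liveFn_flipGate hk h₀, C.liveFn_flipGate hk h₀]
      by_cases hs : C.arg k₀ a₀.rev = .gate k₁
      · rw [decide_eq_true hs]; exact htriv.symm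
      · rw [decide_eq_false hs]; exact htriv⟩
    not_reads_self := E.not_reads_self, arg_eq := E.arg_eq, out_eq := E.out_eq
    op_eq := fun k' => by
      obtain ⟨σ, τ, hσ, hop⟩ := E.op_eq k'
      refine ⟨fun a => σ a ^^ decide (C.arg (E.ι k') a = .gate k₁), τ ^^ decide (E.ι k' = k₁),
        fun a h => ?_, fun p q => ?_⟩
      · show ∃ g, C.arg (E.ι k') a = .gate g
        by_cases hd : C.arg (E.ι k') a = .gate k₁
        · exact ⟨k₁, hd⟩
        · change (σ a ^^ decide (C.arg (E.ι k') a = .gate k₁)) = true at h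
          rw [decide_eq_false hd, Bool.xor_false] at h
          exact hσ a h
      · show E.C'.op k' p q = (C.op (E.ι k') (p ^^ (σ 0 ^^ decide (C.arg (E.ι k') 0 = .gate k₁)))
          (q ^^ (σ 1 ^^ decide (C.arg (E.ι k') 1 = .gate k₁))) ^^ (τ ^^ decide (E.ι k' = k₁)))
        rw [hop, flipGate_op_eq]
        cases σ 0 <;> cases σ 1 <;> cases τ <;> cases decide (C.arg (E.ι k') 0 = .gate k₁) <;>
          cases decide (C.arg (E.ι k') 1 = .gate k₁) <;> cases decide (E.ι k' = k₁) <;> cases p <;> cases q <;>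
          simp
    mem_xorPart_iff := E.mem_xorPart_iff
    potential_le := by
      have := E.potential_le
      unfold potential at this ⊢
      rwa [C.troubledCount_flipGate k₁] at this
    causedBy_of_new_troubled := fun k' hT' hT =>
      E.causedBy_of_new_troubled k' hT' fun h => hT ((C.troubled_flipGate_iff k₁ _).mp h)
    not_troubled := fun h => E.not_troubled ((C.troubled_flipGate_iff k₁ _).mpr h) }

end ElimDataW

variable {d : ℕ}

/-- **Exact elimination data for a gate fed by a constant** (Rules 2/3, output or not), under the
hypotheses of the one-step claim; `Δμ ≥ 1 - α_φ`. [cite: LiYang2022, Lemma 3.11 (Rules 2, 3)] -/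
noncomputable def elimDataWConstFed (hf : IsAffineDisperser f d) (hd : 2 * d + 2 ≤ R.dim) (hF : C.Fair)
    (hC : C.ComputesRestr f R) {P : Finset (Fin C.m × Fin C.m)} (hP : C.IsPacking P)
    {a₀ : Fin 2} {b : Bool} (h₀ : C.arg k₀ a₀ = .const b)
    (hφ : 0 ≤ αφ) (hI : 0 ≤ αI) (αQ : ℝ) : ElimDataW C k₀ f R αφ αI αQ P (1 - αφ) := by
  have hself := hF.not_reads_self_of_const h₀
  by_cases htriv : C.liveFn k₀ a₀ b false = C.liveFn k₀ a₀ b true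
  · exact elimDataWTriv hF hC hP h₀ htriv (out_ne_of_trivialized hf (by omega) hF hC h₀ htriv) hφ hI αQ
  · have hdeg : ∀ t, C.liveFn k₀ a₀ b t = (t ^^ C.liveFn k₀ a₀ b false) :=
      (bool_fn_const_or_xor _).resolve_left htriv
    by_cases hout : C.out = .gate k₀
    · cases hk₁ : C.arg k₀ a₀.rev with
      | const b' => exact absurd hout (out_ne_of_const_const hf (by omega) hF hC h₀ hk₁)
      | var i => exact absurd hout (out_ne_of_live_var hf hd hF hC h₀ hk₁)
      | gate k₁ =>
      have hk : k₀ ≠ k₁ := fun h => hself a₀.rev (by rw [hk₁, h])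
      cases hneg : C.liveFn k₀ a₀ b false with
      | false =>
        rw [hneg] at hdeg
        have hval : ∀ (x : Fin n → Bool) (w : Fin C.m → Bool), C.Consistent x w →
            C.nodeVal x w (C.arg k₀ a₀.rev) = C.nodeVal x w C.out := by
          intro x w hw
          rw [hout]
          show _ = w k₀
          rw [hw k₀, op_eq_liveFn h₀, hdeg, Bool.xor_false]
        refine ElimDataW.ofSetOut (v := C.arg k₀ a₀.rev)
          (elimDataWBypass (C := C.setOut (C.arg k₀ a₀.rev)) (k₀ := k₀) hF.setOut (hC.setOut hval)
            ((C.isPacking_setOut_iff _ P).mpr hP) false h₀ hdeg (hself a₀.rev) hφ hI αQ) ?_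
        show (if C.arg k₀ a₀.rev = .gate k₀ then C.arg k₀ a₀.rev else C.arg k₀ a₀.rev) =
          if C.out = .gate k₀ then C.arg k₀ a₀.rev else C.out
        rw [if_pos hout]; split_ifs <;> rfl
      | true =>
        rw [hneg] at hdeg
        let C₂ := C.flipGate k₁
        have hF₂ : C₂.Fair := hF.flipGate
        have hC₂ : C₂.ComputesRestr f R := hC.flipGate (by rw [hout]; exact fun h => hk (Node.gate.inj h))
        have hP₂ : C₂.IsPacking P := (C.isPacking_flipGate_iff k₁ P).mpr hP
        have hdeg₂ : ∀ t, C₂.liveFn k₀ a₀ b t = (t ^^ false) := fun t => by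
          rw [C.liveFn_flipGate hk h₀, hk₁, decide_eq_true rfl, hdeg]
          cases t <;> rfl
        have hval : ∀ (x : Fin n → Bool) (w : Fin C.m → Bool), C₂.Consistent x w →
            C₂.nodeVal x w (C₂.arg k₀ a₀.rev) = C₂.nodeVal x w C₂.out := by
          intro x w hw
          show C₂.nodeVal x w (C.arg k₀ a₀.rev) = C₂.nodeVal x w C.out
          rw [hout]
          show _ = w k₀
          rw [hw k₀, op_eq_liveFn (C := C₂) h₀, hdeg₂, Bool.xor_false]
        refine ElimDataW.ofFlipGate (k₁ := k₁) (ElimDataW.ofSetOut (v := C.arg k₀ a₀.rev)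
          (elimDataWBypass (C := C₂.setOut (C.arg k₀ a₀.rev)) (k₀ := k₀) hF₂.setOut (hC₂.setOut hval)
            ((C₂.isPacking_setOut_iff _ P).mpr hP₂) false h₀ hdeg₂ (hself a₀.rev) hφ hI αQ) ?_) hk
        show (if C.arg k₀ a₀.rev = .gate k₀ then C.arg k₀ a₀.rev else C.arg k₀ a₀.rev) =
          if C.out = .gate k₀ then C.arg k₀ a₀.rev else C.out
        rw [if_pos hout]; split_ifs <;> rfl
    · exact elimDataWBypass hF hC hP _ h₀ hdeg hout hφ hI αQ

/-- **Exact elimination data for a gate whose function ignores its inputs** (pointwise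
constant value `c`: a trivialized gate fed by a constant, Rule 2; a gate with coinciding wires
and constant `t ↦ op t t`, Rule 5; Li–Yang Lemma 3.12: "replace `G₁` and `G₂` by constants"),
not the output, with coinciding wires or a constant wire (so `ΔΦ ≤ 1`): its readers read `c`,
the `0`-gate is deleted. [cite: LiYang2022, Lemma 3.11 (Rules 2, 5), Lemma 3.12] -/
noncomputable def elimDataWRedirectConst (hF : C.Fair) (hC : C.ComputesRestr f R)
    {P : Finset (Fin C.m × Fin C.m)} (hP : C.IsPacking P) (c : Bool)
    (hid : ∀ (x : Fin n → Bool) (w : Fin C.m → Bool),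
      C.op k₀ (C.nodeVal x w (C.arg k₀ 0)) (C.nodeVal x w (C.arg k₀ 1)) = c)
    (hacc : C.arg k₀ 0 = C.arg k₀ 1 ∨ ∃ (a : Fin 2) (b : Bool), C.arg k₀ a = .const b)
    (hself : ∀ a, C.arg k₀ a ≠ .gate k₀) (hout : C.out ≠ .gate k₀)
    (hφ : 0 ≤ αφ) (hI : 0 ≤ αI) (αQ : ℝ) : ElimDataW C k₀ f R αφ αI αQ P (1 - αφ) := by
  have hk₀ : ¬ C.Troubled k₀ := by
    rcases hacc with h | ⟨a, b, h⟩
    · exact not_troubled_of_coincide h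
    · exact not_troubled_of_reads_const h
  have hid' : ∀ (x : Fin n → Bool) (w : Fin C.m → Bool),
      C.op k₀ (C.nodeVal x w (C.arg k₀ 0)) (C.nodeVal x w (C.arg k₀ 1)) = (C.nodeVal x w (.const c) ^^ false) := by
    intro x w; rw [hid, Bool.xor_false]; rfl
  -- the syntactic values of `k₀` are `c`
  have hsyn : ∀ b, C.SynVal (.gate k₀) b → b = c := by
    intro b hb
    obtain ⟨w, hw, -⟩ := hF (fun _ => false)
    have h1 := hb.nodeVal_eq hw
    have h2 := hw k₀
    rw [hid] at h2
    exact h1.symm.trans h2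
  -- Rule 2's construction
  have hv := C.redirectOK_const k₀ c
  let C₁ := C.redirect k₀ (.const c) false hv
  have hF₁ : C₁.Fair := hF.redirect hself hid'
  have hC₁ : C₁.ComputesRestr f R := hC.redirect hself hid' (fun i h => by cases h)
  have hPμ := C.measure_redirect_const' k₀ hk₀ c false αφ αI αQ hP R
  have h0₁ : ∀ k a, C₁.arg k a ≠ .gate k₀ :=
    (fanout_eq_zero_iff _ _).mp (C.fanout_redirect_self k₀ _ false hv (fun h => by cases h))
  let ε := C₁.skipEquiv k₀
  have hex := C₁.exists_packing_removeGate_le k₀ ε h0₁ hPμ.1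
  have hargs₁ : ∀ a, C₁.arg k₀ a = C.arg k₀ a := fun a => by
    show (if C.arg k₀ a = .gate k₀ then Node.const c else C.arg k₀ a) = _; rw [if_neg (hself a)]
  have hacc₁ : C₁.arg k₀ 0 = C₁.arg k₀ 1 ∨ (∃ b, C₁.arg k₀ 0 = .const b) ∨ ∃ b, C₁.arg k₀ 1 = .const b := by
    rw [hargs₁, hargs₁]
    rcases hacc with h | ⟨a, b, h⟩
    · exact Or.inl h
    · obtain rfl | rfl : a = 0 ∨ a = 1 := by fin_cases a <;> simp
      · exact Or.inr (Or.inl ⟨b, h⟩)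
      · exact Or.inr (Or.inr ⟨b, h⟩)
  have hpot₁ : C₁.potential P = C.potential P := by
    unfold potential
    congr 1
    classical
    unfold troubledCount
    exact congrArg (fun s : Finset (Fin C.m) => (s.card : ℝ))
      (filter_congr fun k _ => C.troubled_redirect_const_iff' k₀ hk₀ c false k)
  refine
    { C' := C₁.removeGate k₀ ε, P' := Classical.choose hex, fair := hF₁.removeGate ε h0₁,
      computes := hC₁.removeGate ε hF₁ h0₁ hout, packing := (Classical.choose_spec hex).1,
      m_add_one := C₁.removeGate_m_add_one k₀ ε, measure_le := ?_,
      ι := fun k => (ε k : Fin C.m), ι_injective := fun k k' h => ε.injective (Subtype.ext h),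
      ι_ne := fun k => (ε k).2, ι_surj := fun k hk => ⟨ε.symm ⟨k, hk⟩, by simp [ε]⟩,
      constFed := fun k' ⟨a, b, h⟩ => ⟨a, b, ?cf⟩,
      trivReaders := fun _ k' ⟨a, h⟩ => ⟨a, c, ?tr⟩,
      doomed_of := fun k' hk => C₁.mem_doomed_removeGate k₀ ε h0₁ (C.mem_doomed_redirect_const k₀ c hsyn hk),
      synVal_of := fun k' b h => ⟨b, ?sv⟩,
      doomed_of_reads := fun b _ k' a hr =>
        C₁.mem_doomed_removeGate k₀ ε h0₁ (C.mem_doomed_redirect_const_of_reads k₀ c hr)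
      repl := .const c
      repl_ne := fun h => by cases h
      repl_cases := Or.inl ⟨c, rfl⟩
      repl_const_of_triv := fun _ => ⟨c, rfl⟩
      not_reads_self := hself
      arg_eq := fun k' a => ?ae
      out_eq := ?oe
      op_eq := fun k' => ⟨fun _ => false, false, (fun a h => by cases h), fun p q => ?op⟩
      mem_xorPart_iff := fun k' => ⟨fun h => (mem_filter.mp h).2, fun h => mem_filter.mpr ⟨mem_univ _, h⟩⟩
      potential_le := ?pl
      causedBy_of_new_troubled := fun k' hT' hT => ?cb
      not_troubled := hk₀ }
  case cf =>
    rw [removeGate_arg]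
    show (if C.arg (ε k') a = .gate k₀ then Node.const c else C.arg (ε k') a).skip k₀ ε = .const b
    rw [h, if_neg (fun h' => by cases h')]; rfl
  case tr =>
    rw [removeGate_arg]
    show (if C.arg (ε k') a = .gate k₀ then Node.const c else C.arg (ε k') a).skip k₀ ε = .const c
    rw [if_pos h]; rfl
  case sv =>
    have := (h.redirect_const C k₀ c hsyn).removeGate C₁ k₀ ε h0₁ (fun h' => (ε k').2 (Node.gate.inj h'))
    simpa [ε] using this
  case ae =>
    show ((C₁.arg (ε k') a).skip k₀ ε).embed (fun k => (ε k : Fin C.m)) = _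
    rw [← Node.unskip_eq_embed, Node.unskip_skip _ _ (h0₁ _ a)]
  case oe =>
    show ((C.out).skip k₀ ε).embed (fun k => (ε k : Fin C.m)) = _
    rw [← Node.unskip_eq_embed, Node.unskip_skip _ _ hout, if_neg hout]
  case op =>
    show C.op _ (p ^^ (false && _)) (q ^^ (false && _)) = (C.op _ (p ^^ false) (q ^^ false) ^^ false)
    rw [Bool.false_and, Bool.false_and, Bool.xor_false, Bool.xor_false, Bool.xor_false]
  case pl =>
    have h := (Classical.choose_spec hex).2
    refine h.trans (le_of_eq ?_)
    rw [hpot₁, if_pos hacc₁]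
  case cb =>
    have hT₁ : ¬ C₁.Troubled (ε k') := fun h => hT ((C.troubled_redirect_const_iff' k₀ hk₀ c false _).mp h)
    obtain ⟨a, ha⟩ := C₁.causedBy_of_new_troubled_removeGate k₀ ε h0₁ hT' hT₁
    refine ⟨a, ?_⟩
    rw [hargs₁] at ha
    exact ha
  · -- the measure
    have hpot : (C₁.removeGate k₀ ε).potential (Classical.choose hex) ≤ C.potential P + 1 := by
      have h := (Classical.choose_spec hex).2
      refine h.trans (le_of_eq ?_)
      rw [hpot₁, if_pos hacc₁]
    have hinf : (((C₁.removeGate k₀ ε).influential R).card : ℝ) ≤ (C.influential R).card := by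
      have := card_le_card (C₁.influential_removeGate_subset k₀ ε h0₁ R)
      rw [C.influential_redirect_const k₀] at this
      exact_mod_cast this
    have hm : (((C.m - 1 : ℕ)) : ℝ) + 1 = C.m := by exact_mod_cast C₁.removeGate_m_add_one k₀ ε
    unfold measure
    show ((C.m - 1 : ℕ) : ℝ) + _ + _ + _ ≤ _
    nlinarith [mul_le_mul_of_nonneg_left hinf hI, mul_le_mul_of_nonneg_left hpot hφ]

end Producers

end Semicircuit

end Literature.Computability.Complexity
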